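import Summits.HodgeConjecture.CorCM.Census.OcticWeilOrbitParts
import Summits.HodgeConjecture.CorCM.OcticWeilFourfoldFrameTransfer
import HarnessLib

/-!
# COR-CM — the GALOIS ORBIT of a simple CM fourfold of Weil type: `E × B₁ × B₂ × B₃` for the three `(2,2)`-types
# `Φ_{I_m}` of ONE octic CM field `F ⊇ k` — FRAME TRANSFER (Galois-balanced weights of every product of copies are
# model-balanced) and the divisor lines of conjugate pairs

Cell `pub-hodgecm2` (COR-CM), seat b30 gen 20 (2026-08-22); count-neutral own lane OCTIC-WEIL-ORBIT (the NEXT SIZED ITEM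
«ORBIT» of gen 19's OCTIC-WEIL22), over the landed kernel census `Census/OcticWeilOrbit` / `Census/OcticWeilOrbitParts`.
Theorems, plus TWO bookkeeping definitions (the slot map `orbitSlots` and the model map `toPt₃`, the four-slot analogues
of `DihedralSexticPairCurve.curveSlots` / `OcticCurveFourfold.toPt`); no named fact, no `sorry`.

SETTING.  A family of CM fields `Kf : I → Type`, `k = Kf i₀` quadratic (`Hom(k, ℂ) = {τ, τ̄}`), `F = Kf i₁` octic with
`i : k → F`; FOUR slots `orbitSlots i₀ i₁ = (i₀, i₁, i₁, i₁)` (`Fin.cons`, so that the field of slot `m+1` is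
DEFINITIONALLY `F`); realisations `A₄ j ⊨ (Kf (orbitSlots j); Φ₄ j)`: `E = A₄ 0 ⊨ (k; {τ})` (`hΨ`) and
`B_m = A₄ (m+1) ⊨ (F; Φ_{I_m})`, `m < 3`, read in a frame `e : Hom(F, ℂ) ≃ Fin 4 × Bool` (`(e s).2 = [s ∘ i = τ]`,
`e s̄ = ((e s).1, ¬(e s).2)`) as `s ∈ Φ_{I_m} ⟺ (e s).2 = [(e s).1 ∈ I_m]`, `I_m = {0, m+1}` (`hΦ`, via the table
`signTab 0` of `Census/OcticWeilOrbit`): three pairwise non-conjugate CM types of `k`-signature `(2,2)`.  THE GALOIS INPUT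
(`hgal`): each of the twelve EVEN permutations `permTab r` of the four conjugate pairs is induced by an automorphism `ρ_r`
of `ℂ`: `ρ_r ∘ e⁻¹(a, true) = e⁻¹(permTab r a, true)` — derived from `2`-transitivity (hence from the simplicity of one
`B_m`, Dodson) in the sequel `CorCM/OcticWeilOrbitRealisers.lean`.

* §0 `orbitSlots`, `toPt₃` (`(0, σ) ↦ inl [σ = τ]`, `(m+1, s) ↦ inr (m, e s)`), `toPt₃_injective`, `toPt₃_conj_smul`.
* §1 `apply_comp_eq_of_realises₃` — such a `ρ_r` acts on the frame by `e (ρ_r ∘ s) = (permTab r (e s).1, (e s).2)`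
  (conjugate pairs to conjugate pairs, all signs kept); `comp_tau_eq_of_realises₃` — it fixes `τ`; hence
  **`comp_mem_iff_toPt₃_mem`**: `ρ_r ∘ x ∈ Φ₄ ⟺ toPt₃ x ∈ phiTab r` (the model's `ρ_r⁻¹(type)`).
* §2 **`modelBalanced₃_of_isGaloisBalancedAlg`** — an `Aut(ℂ)`-balanced weight of `X = ⨁_j A₄(κ j)` (Pohlmann's condition
  for the CM algebra `∏_j K_{κ j}`) is a balanced configuration of the 26-point model (`ModelBalanced₃`: the twelve
  `A₄`-equations) under `v = toPt₃ e τ ∘ P`, `P (j, s) = (κ j, s)`, for EVERY slot map `κ : Fin N → Fin 4`.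
* §3 `weightClassesAlg_le_algebraicClasses_of_isPairPart₃` — a pair part of a weight of `X` (model image a conjugate pair
  `{y, cj₃ y}`) has an algebraic (divisor) line: conjugation-stable on `Y = ⨁ A₄` (`PairWeights.…_of_conj_smul_mem`,
  Lefschetz `(1,1)`), lifted along `κ` by seat b30's distribution lemma.
HONEST FRAMING: nothing about the Hodge conjecture is concluded here; `HC_CM` is not asserted.
[cite: Pohlmann1968, Thm 1] [cite: GaoUllmo2025, Thm 3.1] [cite: Dodson1984, §3.3.2 Theorem] [cite: Shimura1998, §18.2 Lemma (i)]
[cite: Gordon1999HodgeAVSurvey, 9.2.2]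

## References
* [Pohlmann1968] H. Pohlmann, Ann. of Math. 88 (1968), Thm 1.  [GaoUllmo2025] Z. Gao, E. Ullmo, J. Inst. Math. Jussieu 25
  (2025), Thm 3.1 (3.2).  [Dodson1984] B. Dodson, Trans. AMS 283 (1984), §3.3.2 Theorem.  [Shimura1998] G. Shimura,
  *Abelian varieties with complex multiplication and modular functions*, §18.2 Lemma (i).  [Gordon1999HodgeAVSurvey]
  B. B. Gordon, CRM Monogr. 10 (1999), 9.2.2.  [Milne2020HodgeClassesAV] J. S. Milne, arXiv:2010.08857, 1.2 (a), Thm. 1.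
-/

noncomputable section

open CategoryTheory CategoryTheory.Limits NumberField

namespace Summit.HodgeConjecture.CorCM.OcticWeilOrbit

open Literature.AlgebraicGeometry Literature.AlgebraicGeometry.Motives Literature.AlgebraicGeometry.HodgeTheory
open Literature.AlgebraicGeometry.ComplexMultiplication (IsCMTypeRealisation)
open Literature.AlgebraicGeometry.Pohlmann1968
open Literature.AlgebraicTopology.SingularHomology
open Literature.NumberTheory.ComplexMultiplication
open Summit.HodgeConjecture.CorCM.Census.OcticWeilOrbit (Pt₃ cj₃ cj₃_inl cj₃_inr cj₃_facts permTab signTab signTab_eq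
  permTab_facts phiTab inl_mem_phiTab inr_mem_phiTab ModelBalanced₃ IsPairPart₃)
open Summit.HodgeConjecture.CorCM.OcticCurveFourfold (comp_injective comp_conjugate fst_eq_fst_iff)
open Summit.HodgeConjecture.CorCM.CMWeights (weightClassesAlg_comp_le_algebraicClasses_of_injOn)
open Summit.HodgeConjecture.CorCM.PairWeights
open Summit.HodgeConjecture.CorCM.DihedralSexticPairCurvePowers (ncard_sep_eq_card_filter)

open scoped Classical Pointwise

/-! ## §0 The slot map and the model map -/

section Defs

variable {I : Type}

/-- The fields of the four slots of `E × B₁ × B₂ × B₃`: `(i₀, i₁, i₁, i₁)` — `Fin.cons`, so that `orbitSlots i₀ i₁ (m+1)` is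
DEFINITIONALLY `i₁` for every `m : Fin 3`. [folklore] -/
def orbitSlots (i₀ i₁ : I) : Fin 4 → I := Fin.cons i₀ fun _ : Fin 3 => i₁

variable {Kf : I → Type} [∀ i, Field (Kf i)] {i₀ i₁ : I}

/-- **The model map** `Hom(k × F × F × F, ℂ) → Pt₃`: `(0, σ) ↦ inl [σ = τ]`, `(m+1, s) ↦ inr (m, e s)`. [folklore] -/
def toPt₃ (e : (Kf i₁ →+* ℂ) ≃ Fin 4 × Bool) (τ : Kf i₀ →+* ℂ) :
    ((j : Fin 4) × (Kf (orbitSlots i₀ i₁ j) →+* ℂ)) → Pt₃ := fun x =>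
  Fin.cases (motive := fun j => (Kf (orbitSlots i₀ i₁ j) →+* ℂ) → Pt₃)
    (fun σ => Sum.inl (decide (σ = τ))) (fun m s => Sum.inr (m, e s)) x.1 x.2

/-- `toPt₃` on the curve slot. [folklore] -/
@[simp] theorem toPt₃_zero (e : (Kf i₁ →+* ℂ) ≃ Fin 4 × Bool) (τ : Kf i₀ →+* ℂ) (σ : Kf i₀ →+* ℂ) :
    toPt₃ e τ ⟨0, σ⟩ = Sum.inl (decide (σ = τ)) := rfl

/-- `toPt₃` on the fourfold slots. [folklore] -/
@[simp] theorem toPt₃_succ (e : (Kf i₁ →+* ℂ) ≃ Fin 4 × Bool) (τ : Kf i₀ →+* ℂ) (m : Fin 3) (s : Kf i₁ →+* ℂ) :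
    toPt₃ e τ ⟨m.succ, s⟩ = Sum.inr (m, e s) := rfl

end Defs

/-! ## §1 The model map: cases, injectivity, conjugation; how a realiser of `permTab r` acts -/

section Transfer

variable {I : Type} {Kf : I → Type} [∀ i, Field (Kf i)]
  {i₀ i₁ : I} {e : (Kf i₁ →+* ℂ) ≃ Fin 4 × Bool} {τ : Kf i₀ →+* ℂ}
  (hττ : ComplexEmbedding.conjugate τ ≠ τ) (hk : ∀ σ : Kf i₀ →+* ℂ, σ = τ ∨ σ = ComplexEmbedding.conjugate τ)

/-- Every point of the index set is `(0, σ)` or `(m+1, s)`. [folklore] -/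
theorem sigma_cases₃ (x : (j : Fin 4) × (Kf (orbitSlots i₀ i₁ j) →+* ℂ)) :
    (∃ σ : Kf i₀ →+* ℂ, x = ⟨0, σ⟩) ∨ ∃ (m : Fin 3) (s : Kf i₁ →+* ℂ), x = ⟨m.succ, s⟩ := by
  obtain ⟨j, s⟩ := x
  refine Fin.cases ?_ (fun m => ?_) j s
  · exact fun σ => Or.inl ⟨σ, rfl⟩
  · exact fun s => Or.inr ⟨m, s, rfl⟩

include hττ hk in
/-- The model map is injective (`Hom(k, ℂ) = {τ, τ̄}`, `e` a bijection, the slot is recorded). [folklore] -/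
theorem toPt₃_injective : Function.Injective (toPt₃ (i₀ := i₀) (i₁ := i₁) e τ) := by
  intro x y hxy
  rcases sigma_cases₃ x with ⟨σ, rfl⟩ | ⟨m, s, rfl⟩ <;> rcases sigma_cases₃ y with ⟨σ', rfl⟩ | ⟨m', s', rfl⟩
  · rw [toPt₃_zero, toPt₃_zero, Sum.inl.injEq] at hxy
    rcases hk σ with rfl | rfl <;> rcases hk σ' with rfl | rfl
    · rfl
    · simp only [decide_true] at hxy; exact absurd (of_decide_eq_true hxy.symm) hττ
    · simp only [decide_true] at hxy; exact absurd (of_decide_eq_true hxy) hττ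
    · rfl
  · exact absurd hxy (by rw [toPt₃_zero, toPt₃_succ]; exact Sum.inl_ne_inr)
  · exact absurd hxy (by rw [toPt₃_zero, toPt₃_succ]; exact Sum.inr_ne_inl)
  · rw [toPt₃_succ, toPt₃_succ, Sum.inr.injEq, Prod.mk.injEq] at hxy
    obtain ⟨rfl, h2⟩ := hxy
    rw [e.injective h2]

/-- Complex conjugation on the curve slot of the index set. [folklore] -/
theorem conj_smul_zero₃ (σ : Kf i₀ →+* ℂ) :
    (starRingAut : ℂ ≃+* ℂ) • (⟨0, σ⟩ : (j : Fin 4) × (Kf (orbitSlots i₀ i₁ j) →+* ℂ)) =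
      ⟨0, (ComplexEmbedding.conjugate σ : Kf i₀ →+* ℂ)⟩ :=
  Sigma.ext rfl (heq_of_eq (RingHom.ext fun _ => rfl))

/-- Complex conjugation on the fourfold slots of the index set. [folklore] -/
theorem conj_smul_succ₃ (m : Fin 3) (s : Kf i₁ →+* ℂ) :
    (starRingAut : ℂ ≃+* ℂ) • (⟨m.succ, s⟩ : (j : Fin 4) × (Kf (orbitSlots i₀ i₁ j) →+* ℂ)) =
      ⟨m.succ, (ComplexEmbedding.conjugate s : Kf i₁ →+* ℂ)⟩ :=
  Sigma.ext rfl (heq_of_eq (RingHom.ext fun _ => rfl))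

variable {i : Kf i₀ →+* Kf i₁}
  (he_sign : ∀ s : Kf i₁ →+* ℂ, (e s).2 = true ↔ s.comp i = τ)
  (he_conj : ∀ s : Kf i₁ →+* ℂ, e (ComplexEmbedding.conjugate s) = ((e s).1, !(e s).2))

include he_conj hττ hk in
/-- Conjugation is read in the model: `toPt₃ x̄ = cj₃ (toPt₃ x)`. [folklore] -/
theorem toPt₃_conj_smul (x : (j : Fin 4) × (Kf (orbitSlots i₀ i₁ j) →+* ℂ)) :
    toPt₃ e τ ((starRingAut : ℂ ≃+* ℂ) • x) = cj₃ (toPt₃ e τ x) := by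
  rcases sigma_cases₃ x with ⟨σ, rfl⟩ | ⟨m, s, rfl⟩
  · have key : decide (ComplexEmbedding.conjugate σ = τ) = !decide (σ = τ) := by
      rcases hk σ with rfl | rfl
      · rw [decide_eq_false hττ]; simp
      · rw [ComplexEmbedding.involutive_conjugate, decide_eq_false hττ]; simp
    rw [conj_smul_zero₃, toPt₃_zero, toPt₃_zero, key, cj₃_inl]
  · rw [conj_smul_succ₃, toPt₃_succ, toPt₃_succ, he_conj, cj₃_inr]

/-! ### How a realiser of the even permutation `permTab r` acts -/

include he_conj in
/-- **A realiser of `permTab r` acts on the frame by `e (ρ ∘ s) = (permTab r (e s).1, (e s).2)`**: it maps the pair `a` to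
the pair `permTab r a` keeping the member over `τ`, and commutes with complex conjugation (`comp_conjugate`), so it keeps
the other member too. [cite: Shimura1998, §18.2 Lemma (i)] [cite: Dodson1984, §3.1.1] -/
theorem apply_comp_eq_of_realises₃ [NumberField (Kf i₁)] [IsCMField (Kf i₁)] (ρ : ℂ ≃+* ℂ) {r : Fin 12}
    (hρ : ∀ a : Fin 4, (ρ : ℂ →+* ℂ).comp (e.symm (a, true)) = e.symm (permTab r a, true)) (s : Kf i₁ →+* ℂ) :
    e ((ρ : ℂ →+* ℂ).comp s) = (permTab r (e s).1, (e s).2) := by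
  cases h2 : (e s).2
  · -- `s` is the conjugate of the member `e⁻¹((e s).1, true)` of its pair
    have hs : s = ComplexEmbedding.conjugate (e.symm ((e s).1, true)) := by
      apply e.injective
      rw [he_conj, Equiv.apply_symm_apply]
      exact Prod.ext rfl (by rw [h2]; rfl)
    rw [hs, comp_conjugate ρ, he_conj, hρ, Equiv.apply_symm_apply, ← hs]
    rfl
  · have hs : s = e.symm ((e s).1, true) := by
      apply e.injective
      rw [Equiv.apply_symm_apply]
      exact Prod.ext rfl h2
    rw [hs, hρ, Equiv.apply_symm_apply, ← hs]

include he_sign in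
/-- **A realiser of `permTab r` fixes `τ`** (`e⁻¹(0, true)` and its image both lie over `τ`). [cite: Dodson1984, §3.1.1] -/
theorem comp_tau_eq_of_realises₃ (ρ : ℂ ≃+* ℂ) {r : Fin 12}
    (hρ : ∀ a : Fin 4, (ρ : ℂ →+* ℂ).comp (e.symm (a, true)) = e.symm (permTab r a, true)) :
    (ρ : ℂ →+* ℂ).comp τ = τ := by
  have h0 : (e.symm ((0 : Fin 4), true)).comp i = τ := (he_sign _).1 (by rw [Equiv.apply_symm_apply])
  have h1 : (e.symm (permTab r 0, true)).comp i = τ := (he_sign _).1 (by rw [Equiv.apply_symm_apply])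
  calc (ρ : ℂ →+* ℂ).comp τ = ((ρ : ℂ →+* ℂ).comp (e.symm (0, true))).comp i := by rw [RingHom.comp_assoc, h0]
    _ = τ := by rw [hρ, h1]

include hττ hk he_sign in
/-- Hence on `Hom(k, ℂ) = {τ, τ̄}`: `ρ ∘ σ = τ ⟺ σ = τ`. [folklore] -/
theorem comp_eq_tau_iff_of_realises₃ (ρ : ℂ ≃+* ℂ) {r : Fin 12}
    (hρ : ∀ a : Fin 4, (ρ : ℂ →+* ℂ).comp (e.symm (a, true)) = e.symm (permTab r a, true)) (σ : Kf i₀ →+* ℂ) :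
    (ρ : ℂ →+* ℂ).comp σ = τ ↔ σ = τ := by
  have hρτ := comp_tau_eq_of_realises₃ he_sign ρ hρ
  rcases hk σ with rfl | rfl
  · exact ⟨fun _ => rfl, fun _ => hρτ⟩
  · constructor
    · intro h
      exact absurd (comp_injective (K := Kf i₀) ρ (h.trans hρτ.symm)) hττ
    · intro h
      exact absurd h hττ

/-- The table identity `[permTab r a ∈ I_m] = signTab r m a` read through row `0` (the identity permutation):
`signTab 0 m (permTab r a) = signTab r m a`. [folklore] -/
theorem signTab_zero_permTab : ∀ (r : Fin 12) (m : Fin 3) (a : Fin 4), signTab 0 m (permTab r a) = signTab r m a := by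
  decide +kernel

variable {Φ₄ : ∀ j : Fin 4, CMType (Kf (orbitSlots i₀ i₁ j))}
  (hΦ : ∀ (m : Fin 3) (s : Kf i₁ →+* ℂ), s ∈ (Φ₄ m.succ).1 ↔ (e s).2 = signTab 0 m (e s).1)
  (hΨ : ∀ σ : Kf i₀ →+* ℂ, σ ∈ (Φ₄ 0).1 ↔ σ = τ)

include he_conj hΦ in
/-- **How a realiser of `permTab r` acts on a fourfold slot of type `m`**: `ρ ∘ s ∈ Φ_{I_m} ⟺ inr (m, e s) ∈ phiTab r`
(`ρ` keeps signs and moves the pair `a` to `permTab r a`; `signTab r m a = [permTab r a ∈ I_m]`).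
[cite: GaoUllmo2025, Thm 3.1 (3.2)] [cite: Dodson1984, §3.1.1] -/
theorem comp_mem_iff_of_realises₃ [NumberField (Kf i₁)] [IsCMField (Kf i₁)] (ρ : ℂ ≃+* ℂ) {r : Fin 12}
    (hρ : ∀ a : Fin 4, (ρ : ℂ →+* ℂ).comp (e.symm (a, true)) = e.symm (permTab r a, true)) (m : Fin 3)
    (s : Kf i₁ →+* ℂ) : (ρ : ℂ →+* ℂ).comp s ∈ (Φ₄ m.succ).1 ↔ (Sum.inr (m, e s) : Pt₃) ∈ phiTab r := by
  rw [hΦ, apply_comp_eq_of_realises₃ he_conj ρ hρ s, inr_mem_phiTab, signTab_zero_permTab]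

include hττ hk he_sign he_conj hΦ hΨ in
/-- **Membership read in the frame**: for a realiser `ρ` of `permTab r`, `ρ ∘ x ∈ Φ₄ ↔ toPt₃ x ∈ phiTab r` (on the curve
slot `ρ` fixes `τ`, and `inl c ∈ phiTab r ↔ c = true`). [cite: GaoUllmo2025, Thm 3.1 (3.2)] -/
theorem comp_mem_iff_toPt₃_mem [NumberField (Kf i₁)] [IsCMField (Kf i₁)] {ρ : ℂ ≃+* ℂ} {r : Fin 12}
    (hρ : ∀ a : Fin 4, (ρ : ℂ →+* ℂ).comp (e.symm (a, true)) = e.symm (permTab r a, true))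
    (x : (j : Fin 4) × (Kf (orbitSlots i₀ i₁ j) →+* ℂ)) :
    (ρ : ℂ →+* ℂ).comp x.2 ∈ (Φ₄ x.1).1 ↔ toPt₃ e τ x ∈ phiTab r := by
  rcases sigma_cases₃ x with ⟨σ, rfl⟩ | ⟨m, s, rfl⟩
  · change (ρ : ℂ →+* ℂ).comp σ ∈ (Φ₄ 0).1 ↔ _
    rw [hΨ, toPt₃_zero, inl_mem_phiTab, comp_eq_tau_iff_of_realises₃ hττ hk he_sign ρ hρ σ]
    exact ⟨fun h => decide_eq_true h, fun h => of_decide_eq_true h⟩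
  · exact comp_mem_iff_of_realises₃ he_conj hΦ ρ hρ m s

/-! ## §2 Frame transfer for the products of copies -/

variable {N : ℕ} (κ : Fin N → Fin 4)

include hττ hk he_sign he_conj hΦ hΨ in
/-- **FRAME TRANSFER** (`A₄`-realisation): an `Aut(ℂ)`-balanced weight of `X = ⨁_j A₄(κ j)` (`IsGaloisBalancedAlg` for the CM
algebra `∏_j K_{κ j}`, types `Φ₄ (κ j)`) is a balanced configuration of the model of `Census/OcticWeilOrbit` under
`v = toPt₃ e τ ∘ P`, `P (j, s) = (κ j, s)`: each even permutation `permTab r` of the conjugate pairs is realised by an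
automorphism of `ℂ` (`hgal`), whose balance condition is the model's `r`-th equation.
[cite: GaoUllmo2025, Thm 3.1 (3.2)] [cite: Pohlmann1968, Thm 1] [cite: Dodson1984, §3.3.2 Theorem] -/
theorem modelBalanced₃_of_isGaloisBalancedAlg [NumberField (Kf i₁)] [IsCMField (Kf i₁)]
    (hgal : ∀ r : Fin 12, ∃ ρ : ℂ ≃+* ℂ,
      ∀ a : Fin 4, (ρ : ℂ →+* ℂ).comp (e.symm (a, true)) = e.symm (permTab r a, true))
    {S : Finset ((j : Fin N) × (Kf (orbitSlots i₀ i₁ (κ j)) →+* ℂ))}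
    (hS : IsGaloisBalancedAlg (K := fun j => Kf (orbitSlots i₀ i₁ (κ j))) (fun j => Φ₄ (κ j)) S) :
    ModelBalanced₃ (fun x => toPt₃ e τ ((Sigma.map κ (fun _ => id) :
      ((j : Fin N) × (Kf (orbitSlots i₀ i₁ (κ j)) →+* ℂ)) → ((m : Fin 4) × (Kf (orbitSlots i₀ i₁ m) →+* ℂ))) x)) S := by
  intro r
  beta_reduce
  obtain ⟨ρ, hρ⟩ := hgal r
  have h := hS ρ
  rw [ncard_sep_eq_card_filter, ncard_sep_eq_card_filter] at h
  have key : ∀ x : (j : Fin N) × (Kf (orbitSlots i₀ i₁ (κ j)) →+* ℂ),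
      (ρ : ℂ →+* ℂ).comp x.2 ∈ (Φ₄ (κ x.1)).1 ↔ toPt₃ e τ ((Sigma.map κ (fun _ => id) :
        ((j : Fin N) × (Kf (orbitSlots i₀ i₁ (κ j)) →+* ℂ)) → ((m : Fin 4) × (Kf (orbitSlots i₀ i₁ m) →+* ℂ))) x)
          ∈ phiTab r :=
    fun x => comp_mem_iff_toPt₃_mem hττ hk he_sign he_conj hΦ hΨ hρ ⟨κ x.1, x.2⟩
  rw [Finset.filter_congr fun x _ => key x, Finset.filter_congr fun x _ => (key x).not] at h
  have htot := Finset.card_filter_add_card_filter_not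
    (s := S) (fun x => toPt₃ e τ ((Sigma.map κ (fun _ => id) :
        ((j : Fin N) × (Kf (orbitSlots i₀ i₁ (κ j)) →+* ℂ)) → ((m : Fin 4) × (Kf (orbitSlots i₀ i₁ m) →+* ℂ))) x)
          ∈ phiTab r)
  omega

end Transfer

/-! ## §3 Conjugate pairs have algebraic (divisor) lines -/

section Pairs

variable {I : Type} {Kf : I → Type} [∀ i, Field (Kf i)] [∀ i, NumberField (Kf i)] [∀ i, IsCMField (Kf i)]
  {i₀ i₁ : I} {N : ℕ} (κ : Fin N → Fin 4) {e : (Kf i₁ →+* ℂ) ≃ Fin 4 × Bool} {τ : Kf i₀ →+* ℂ}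
  (hττ : ComplexEmbedding.conjugate τ ≠ τ) (hk : ∀ σ : Kf i₀ →+* ℂ, σ = τ ∨ σ = ComplexEmbedding.conjugate τ)
  (he_conj : ∀ s : Kf i₁ →+* ℂ, e (ComplexEmbedding.conjugate s) = ((e s).1, !(e s).2))
  {A₄ : Fin 4 → AbelianVariety ℂ} {Φ₄ : ∀ j : Fin 4, CMType (Kf (orbitSlots i₀ i₁ j))}
  {ι₄ : ∀ j, 𝓞 (Kf (orbitSlots i₀ i₁ j)) →+* End (A₄ j)}
  {θ₄ : ∀ j, Kf (orbitSlots i₀ i₁ j) →+* Module.End ℂ (complexBetti (A₄ j).X 1)}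
  (hA : ∀ j, IsCMTypeRealisation (Φ₄ j) (A₄ j) (ι₄ j) (θ₄ j))

include hττ hk he_conj hA in
/-- **A weight of `Y = ⨁ A₄` whose model image is a conjugate pair `{y, cj₃ y}` is conjugation-stable, so its line is
algebraic** (a divisor line: Lefschetz `(1,1)` on the abelian variety `⨁ A₄`). [cite: Gordon1999HodgeAVSurvey, 9.2.2] -/
theorem weightClassesAlg_le_algebraicClasses_of_image_eq_pair₃
    {T : Finset ((j : Fin 4) × (Kf (orbitSlots i₀ i₁ j) →+* ℂ))} {y : Pt₃} (hT : T.image (toPt₃ e τ) = {y, cj₃ y}) :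
    T.card = 2 ∧ weightClassesAlg A₄ ι₄ (2 * 1) T ≤ algebraicClasses (⨁ A₄).X 1 := by
  have hinj := toPt₃_injective (e := e) hττ hk (i₁ := i₁)
  have hcard : T.card = 2 := by
    rw [← Finset.card_image_of_injective T hinj, hT]
    exact Finset.card_pair (cj₃_facts.2 y).symm
  refine ⟨hcard, weightClassesAlg_le_algebraicClasses_of_conj_smul_mem hA (m := 1) hcard fun x hx => ?_⟩
  have hx' : toPt₃ e τ x ∈ ({y, cj₃ y} : Finset Pt₃) := hT ▸ Finset.mem_image_of_mem _ hx
  have hcx : toPt₃ e τ ((starRingAut : ℂ ≃+* ℂ) • x) ∈ T.image (toPt₃ e τ) := by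
    rw [toPt₃_conj_smul hττ hk he_conj x, hT, Finset.mem_insert, Finset.mem_singleton] at *
    rcases hx' with h | h
    · exact Or.inr (by rw [h])
    · exact Or.inl (by rw [h, cj₃_facts.1])
  exact (hinj.mem_finset_image).1 hcx

include hττ hk he_conj hA in
/-- **A pair part of a weight of `X = ⨁_j A₄(κ j)` has an algebraic (divisor) line**: the model map is injective on it
with image a conjugate pair, so its slot projection to `Y = ⨁ A₄` is a weight with the same image — a divisor line — and
seat b30's distribution lemma lifts it along `κ`. [cite: Gordon1999HodgeAVSurvey, 9.2.2]
[cite: Milne2020HodgeClassesAV, 1.2 (a) and Thm. 1] -/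
theorem weightClassesAlg_le_algebraicClasses_of_isPairPart₃
    {G : Finset ((j : Fin N) × (Kf (orbitSlots i₀ i₁ (κ j)) →+* ℂ))}
    (hG : IsPairPart₃ (fun x => toPt₃ e τ ((Sigma.map κ (fun _ => id) :
      ((j : Fin N) × (Kf (orbitSlots i₀ i₁ (κ j)) →+* ℂ)) → ((m : Fin 4) × (Kf (orbitSlots i₀ i₁ m) →+* ℂ))) x)) G) :
    G.card = 2 * 1 ∧ weightClassesAlg (fun j => A₄ (κ j)) (fun j => ι₄ (κ j)) (2 * 1) G ≤
      algebraicClasses (⨁ fun j => A₄ (κ j)).X 1 := by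
  obtain ⟨y, hcard, hinj, himg⟩ := hG
  set P : ((j : Fin N) × (Kf (orbitSlots i₀ i₁ (κ j)) →+* ℂ)) → ((m : Fin 4) × (Kf (orbitSlots i₀ i₁ m) →+* ℂ)) :=
    Sigma.map κ (fun _ => id) with hP
  have hPinj : Set.InjOn P ↑G := fun x hx x' hx' h => hinj hx hx' (by change toPt₃ e τ (P x) = toPt₃ e τ (P x'); rw [h])
  set TY : Finset ((m : Fin 4) × (Kf (orbitSlots i₀ i₁ m) →+* ℂ)) := G.image P with hTY
  have hTYimg : TY.image (toPt₃ e τ) = {y, cj₃ y} := by rw [hTY, Finset.image_image]; exact himg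
  obtain ⟨-, hYalg⟩ := weightClassesAlg_le_algebraicClasses_of_image_eq_pair₃ hττ hk he_conj hA hTYimg
  have hq : G.card = 2 * 1 := by rw [hcard]
  exact ⟨hq, weightClassesAlg_comp_le_algebraicClasses_of_injOn (K := fun m => Kf (orbitSlots i₀ i₁ m)) hA κ hq
    hPinj hYalg⟩

end Pairs

end Summit.HodgeConjecture.CorCM.OcticWeilOrbit

end
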